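import Literature.MathematicalPhysics.QuantumFieldTheory.Balaban1983to89.B9Eq340HolderRowOfGradientRow
import Literature.MathematicalPhysics.QuantumFieldTheory.Balaban1983to89.B9Eq347GlobalFromLocal

/-!
# `Balaban1983to89.B9Eq340WeightedHolderRowsProjectionStep` — T. Bałaban, *Propagators for lattice gauge theories in a background field*, Commun. Math. Phys. **99**
# (1985) 389–434 [Balaban1985BackgroundPropagators] (3.25) p. 394 (*«Rf = (I − G′Q′\*(Q′G′²Q′\*)⁻¹Q′G′)f»*), (3.40) p. 397, Thm 3.1 (3.42)–(3.43), (3.47) pp. 397–398,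
# with [Balaban1984PropagatorsII] Lemma 2.1 (2.60)–(2.61) p. 234: **THE `R_k`-STEP OF STOREY H IN THE WEIGHTED HÖLDER CURRENCY — for an operator `X` with a LOCAL value
# letter and a LOCAL covariant-gradient letter (rate `κ`) and a field `ν` with weighted value ∕ η-scale Hölder rows `(N, H; δ₁, ε)`, the field `ω = ν − Xν` has weighted
# value row `N + N′` and weighted Hölder row `H + d(N′ + 2M_φM_φ′αN′)e^{δ₂}`, `δ₂ = min(δ₁, κ∕2)`, `N′ = B_XK_d(κ−δ₂)N`** — so the displayed letter (HLa) of this lineage's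
# HJ-2 (`R_kG′_kD*_U`: sup → weighted value + Hölder) reduces to (HLa₀) = the same for `G′_kD*_U` alone (print's (3.43)₂) plus the two sup-currency letters of
# `X = G′_kQ̃′_k†c_kQ̃′_kG′_k` (composites of LANDED rows: (DRC) `exists_decayRow_GpOfUk`, (GRC) `exists_gradRow_GpOfUk`, (K64a) `exists_local_letter_QGGQInvk_closed`,
# the averaging letters — pattern ne9-leaf-03 g80's `B9Eq3152ProjGreenPrimeGradRowClosed`); plus the weighted (3.47)-summation it rests on; NE9 crux-team LEAF
# PROVER 01, gen 92

statement-level skeleton of published theorems with citation tags; proofs where landed; nothing here is a claim about the Yang–Mills mass gap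

CITATION HEADER (lean-in-tree rule).  Audit cell `pub-balaban`, sub-cell `t4`, BINDER row NE9; filed by NE9 crux-team LEAF PROVER 01 (`b2b-balaban-t4-ne9-formalise-leaf-01`,
gen 92; bears_on: R4/N22).  Source READ first-hand this generation (`paper:balaban1985-cmp99-background-propagators`, journal page = PDF page + 388): p. 394 (3.25), pp. 397–398
(3.40)–(3.47).  BY NAME: ne9-leaf-03's (G) `B9Eq347GlobalFromLocal.weight_mul_norm_apply_le_of_local` (the weighted local → global summation), this lineage's (HJ-3)
`B9Eq340HolderRowOfGradientRow.holderRow_of_gradientRow`, `B4Sect5Torus.torusSum_le`, `B4Sect5Proof.latticeConst`.  The operator `X` and its two letters are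
HYPOTHESES (abstract linear map on the site functions); nothing of (3.25) is asserted.

WHAT IS PROVED (sorry-free; proof lane — 0 `def`; [folklore]).
* **`weighted_row_of_local`** — weighted global row (rate `δ₂`) from a local letter (rate `κ > δ₂`) for inputs weighted at rate `δ₁ ≥ δ₂`, any output index map `π′`
  (sites or bonds), on any fine torus `P = (Km)` through `siteCast`.
* **`weightedHolderRows_sub_of_localLetters`** — the statement of the title.
HONEST SCOPE.  Bookkeeping only; NO propagator is named; the instantiation `X := G′_kQ̃′_k†c_kQ̃′_kG′_k` (its two local letters from landed rows) and (HLa₀) itself are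
NOT here; «NE9 ⇐ the named binders»; NE9 NOT PRINTED ∕ NOT PROVED; row WALLED ON A MODEL (O-NE9-1; #5 UNRULED); spine PROVED 0∕9; rung (B)+1 on a finite T⁴ — NOT
infinite volume, NOT mass gap, NOT BetaPertH, NOT Clay.  HONEST DEPENDENCY: continuum YM on T⁴ ⇐ BetaPertH ∧ nine spine estimates (0/9 proved); BetaPertH ⇐ (D1) ∧ (D4)
∧ CAP+tail; G-an2-4 gates asym, D1 and NE2/3/4.  NEW file importing (HJ-3) and (G); nothing modified.  Net new unproved facts: 0.
-/

noncomputable section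

set_option autoImplicit false

open scoped BigOperators

namespace Literature.MathematicalPhysics.QuantumFieldTheory.Balaban1983to89.B9Eq340WeightedHolderRowsProjectionStep

open B4Sect5Torus (TSite tdist ccoord tdist_nonneg tdist_triangle tdist_symm torusSum_le)
open B4Sect5Proof (latticeConst latticeConst_nonneg)
open B9SectCLatticeCarrier (Bond bpos btgt shift)
open B9Eq319QprimeTorus (fineP blockCoord)
open B9Eq316TowerFlatIsOneStep (siteCast)
open B9Eq33CovDerivVector (covDeriv)
open B9Eq310HessianOperator (adTransportW)
open B7Prop1Explicit (U1)
open B9Eq347GlobalFromLocal (weight_mul_norm_apply_le_of_local)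
open B9Eq340HolderRowOfGradientRow (holderRow_of_gradientRow)

variable {d : ℕ} (K : ℕ) [NeZero K] (m : Fin d → ℕ) [∀ i, NeZero (m i)]
  {𝔸 : Type*} [NormedRing 𝔸] [NormedAlgebra ℂ 𝔸] [NormOneClass 𝔸]
  {W : Type*} [NormedAddCommGroup W] [InnerProductSpace ℂ W] (φ : W ≃ₗ[ℂ] 𝔸) {Mφ Mφ' : ℝ}
  (hφ : ∀ w, ‖φ w‖ ≤ Mφ * ‖w‖) (hφ' : ∀ X, ‖φ.symm X‖ ≤ Mφ' * ‖X‖) (hMφ : 0 ≤ Mφ) (hMφ' : 0 ≤ Mφ')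

omit [NeZero K] [∀ i, NeZero (m i)] in
/-- **A WEIGHTED GLOBAL ROW FROM A LOCAL LETTER** on a fine torus read through `siteCast` ((3.47) from (3.42) «and Lemma 2.1», with the exponential weights
`e^{δ₂ d_m(·, v)}` of ne9-leaf-03's `B9Eq347GlobalFromLocal.weight_mul_norm_apply_le_of_local`): an input with `‖f(y)‖ ≤ N·e^{−δ₁ d_m(Πy, v)}` and a local letter of
`T` with rate `κ` give `‖(Tf)(x)‖ ≤ B_X·K_d(κ − δ₂)·N·e^{−δ₂ d_m(π′x, v)}` for every output rate `0 ≤ δ₂ ≤ δ₁`, `δ₂ < κ`. [folklore]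
[cite: Balaban1985BackgroundPropagators, Thm 3.1 (3.47) p.398, (3.42) p.397] [cite: Balaban1984PropagatorsII, Lemma 2.1 (2.60)-(2.61) p.234] -/
theorem weighted_row_of_local {P : Fin d → ℕ} (h : P = fineP K m) (hm : ∀ i, 1 ≤ m i) {X' : Type*} {V : Type*} [NormedAddCommGroup V] [NormedSpace ℂ V]
    (T : (TSite d P → W) →ₗ[ℂ] (X' → V)) (π' : X' → TSite d m) {BX κ N δ₁ δ₂ : ℝ} (hBX : 0 ≤ BX) (hN : 0 ≤ N) (hδ₂0 : 0 ≤ δ₂) (hδ₂1 : δ₂ ≤ δ₁) (hδ₂κ : δ₂ < κ)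
    (hloc : ∀ (v' : TSite d m) (g : TSite d P → W) (F : ℝ), (∀ y, blockCoord K m (siteCast h y) ≠ v' → g y = 0) → (∀ y, ‖g y‖ ≤ F) →
      ∀ x, ‖T g x‖ ≤ BX * Real.exp (-(κ * tdist m (π' x) v')) * F)
    (v : TSite d m) (f : TSite d P → W) (hf : ∀ y, ‖f y‖ ≤ N * Real.exp (-(δ₁ * tdist m (blockCoord K m (siteCast h y)) v))) (x : X') :
    ‖T f x‖ ≤ BX * latticeConst d (κ - δ₂) * N * Real.exp (-(δ₂ * tdist m (π' x) v)) := by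
  have hω : ∀ u : TSite d m, 0 < Real.exp (δ₂ * tdist m u v) := fun u => Real.exp_pos _
  have key := weight_mul_norm_apply_le_of_local (𝕜 := ℂ) (fun y : TSite d P => blockCoord K m (siteCast h y)) π' (tdist m) T
    (B := BX) (κ := κ) (κ₂ := δ₂) (R := 1) (S := latticeConst d (κ - δ₂)) (a := fun _ => 1)
    (ω := fun u => Real.exp (δ₂ * tdist m u v)) (ω' := fun u => Real.exp (δ₂ * tdist m u v)) hBX zero_le_one hω (fun u => (hω u).le)
    (fun v' g F hg hF x => by rw [mul_one]; exact hloc v' g F hg hF x)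
    (fun u v' => by
      rw [mul_one, one_mul, ← Real.exp_add]
      refine Real.exp_le_exp.2 ?_
      have := tdist_triangle hm u v' v
      nlinarith [mul_le_mul_of_nonneg_left this hδ₂0])
    (fun u => torusSum_le d hm (sub_pos.2 hδ₂κ) u) f hN
    (fun y => by
      have h1 := hf y
      have hd := tdist_nonneg m (blockCoord K m (siteCast h y)) v
      calc Real.exp (δ₂ * tdist m (blockCoord K m (siteCast h y)) v) * ‖f y‖
          ≤ Real.exp (δ₂ * tdist m (blockCoord K m (siteCast h y)) v) * (N * Real.exp (-(δ₁ * tdist m (blockCoord K m (siteCast h y)) v))) :=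
            mul_le_mul_of_nonneg_left h1 (hω _).le
        _ = N * Real.exp (δ₂ * tdist m (blockCoord K m (siteCast h y)) v + -(δ₁ * tdist m (blockCoord K m (siteCast h y)) v)) := by
            rw [Real.exp_add]; ring
        _ ≤ N * Real.exp 0 := mul_le_mul_of_nonneg_left (Real.exp_le_exp.2 (by nlinarith [mul_le_mul_of_nonneg_right hδ₂1 hd])) hN
        _ = N := by rw [Real.exp_zero, mul_one])
    x
  -- unweight the output
  have hω' := hω (π' x)
  rw [mul_one] at key
  have e : BX * latticeConst d (κ - δ₂) * N * Real.exp (-(δ₂ * tdist m (π' x) v)) * Real.exp (δ₂ * tdist m (π' x) v) =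
      BX * latticeConst d (κ - δ₂) * N := by
    rw [mul_assoc, ← Real.exp_add, neg_add_cancel, Real.exp_zero, mul_one]
  have : Real.exp (δ₂ * tdist m (π' x) v) * ‖T f x‖ ≤
      Real.exp (δ₂ * tdist m (π' x) v) * (BX * latticeConst d (κ - δ₂) * N * Real.exp (-(δ₂ * tdist m (π' x) v))) := by
    rw [mul_comm (Real.exp _) (BX * _ * _ * _), e]; exact key
  exact le_of_mul_le_mul_left this hω'

include hφ hφ' hMφ hMφ' in
/-- **THE PROJECTION STEP `ω = ν − Xν` IN THE WEIGHTED HÖLDER CURRENCY** (print's `R = I − G′Q′*(Q′G′²Q′*)⁻¹Q′G′` of (3.25) acting on a Hölder field, with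
`X := G′_kQ̃′_k†c_kQ̃′_kG′_k` left ABSTRACT): on the fine torus `T_{(Km)}` in the small gauge, if `ν` has weighted value ∕ η-scale Hölder rows `(N, H; δ₁, ε)` centred at
`v` and `X` has a LOCAL value letter and a LOCAL covariant-gradient letter (block-supported input → output decaying at rate `κ`; the shapes of the cell's landed
rows `exists_decayRow_GpOfUk` ∕ `exists_gradRow_GpOfUk` composed with the averaging letters), then `ω = ν − Xν` has weighted value row `N + N′` and weighted
η-scale Hölder row `H + d·(N′ + 2M_φM_φ′αN′)·e^{δ₂}` at the rate `δ₂ = min(δ₁, κ∕2)`, `N′ = B_X·K_d(κ − δ₂)·N` — `weighted_row_of_local` twice (value, gradient of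
`Xν`) and `B9Eq340HolderRowOfGradientRow.holderRow_of_gradientRow` (a Lipschitz field at the unit scale is Hölder).  This is the `R_k`-step of the displayed letter
(HLa) of this lineage's HJ-2 `B9Eq3152ThirdWordPiGradRowOfHolderLetters`, reduced to (3.43)₂ for `G′_kD*_U` plus two sup-currency letters of `X`. [folklore]
[cite: Balaban1985BackgroundPropagators, (3.25) p.394, (3.40) p.397, Thm 3.1 (3.42)–(3.43) pp.397–398, (3.47) p.398] -/
theorem weightedHolderRows_sub_of_localLetters {P : Fin d → ℕ} (h : P = fineP K m) (hm : ∀ i, 1 ≤ m i) (U : Bond d P → 𝔸ˣ) {α η : ℝ} (hη : 0 < η)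
    (hηK : η * K = 1) (hα : 0 ≤ α) (hUb : ∀ b, U b ∈ U1 𝔸) (hUη : ∀ b, ‖(U b : 𝔸) - 1‖ ≤ α * η)
    (X : (TSite d P → W) →ₗ[ℂ] (TSite d P → W)) {BX κ : ℝ} (hBX : 0 ≤ BX) (hκ : 0 < κ)
    (hXv : ∀ (v' : TSite d m) (g : TSite d P → W) (F : ℝ), (∀ y, blockCoord K m (siteCast h y) ≠ v' → g y = 0) → (∀ y, ‖g y‖ ≤ F) →
      ∀ x, ‖X g x‖ ≤ BX * Real.exp (-(κ * tdist m (blockCoord K m (siteCast h x)) v')) * F)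
    (hXg : ∀ (v' : TSite d m) (g : TSite d P → W) (F : ℝ), (∀ y, blockCoord K m (siteCast h y) ≠ v' → g y = 0) → (∀ y, ‖g y‖ ≤ F) →
      ∀ b : Bond d P, ‖covDeriv ((η : ℂ))⁻¹ (adTransportW φ U) (X g) b‖ ≤ BX * Real.exp (-(κ * tdist m (blockCoord K m (siteCast h (bpos b))) v')) * F)
    (ν : TSite d P → W) (v : TSite d m) {N H δ₁ ε : ℝ} (hN : 0 ≤ N) (hH : 0 ≤ H) (hδ₁ : 0 ≤ δ₁) (hε1 : ε ≤ 1)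
    (hνv : ∀ x, ‖ν x‖ ≤ N * Real.exp (-(δ₁ * tdist m (blockCoord K m (siteCast h x)) v)))
    (hνh : ∀ x x', tdist P x x' ≤ K →
      ‖ν x' - ν x‖ ≤ H * Real.exp (-(δ₁ * tdist m (blockCoord K m (siteCast h x)) v)) * (tdist P x x' / K) ^ ε) :
    let δ₂ : ℝ := min δ₁ (κ / 2)
    let N' : ℝ := BX * latticeConst d (κ - δ₂) * N
    (∀ x, ‖(ν - X ν) x‖ ≤ (N + N') * Real.exp (-(δ₂ * tdist m (blockCoord K m (siteCast h x)) v))) ∧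
    (∀ x x', tdist P x x' ≤ K →
      ‖(ν - X ν) x' - (ν - X ν) x‖ ≤ (H + d * (N' + 2 * Mφ * Mφ' * α * N') * Real.exp δ₂) *
        Real.exp (-(δ₂ * tdist m (blockCoord K m (siteCast h x)) v)) * (tdist P x x' / K) ^ ε) := by
  intro δ₂ N'
  have hδ₂0 : 0 ≤ δ₂ := le_min hδ₁ (by positivity)
  have hδ₂1 : δ₂ ≤ δ₁ := min_le_left _ _
  have hδ₂κ : δ₂ < κ := (min_le_right _ _).trans_lt (by linarith)
  have hKc : 0 ≤ latticeConst d (κ - δ₂) := latticeConst_nonneg d (by linarith)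
  have hN' : 0 ≤ N' := by positivity
  -- the weighted rows of `Xν`: value and covariant gradient
  have hXνv : ∀ x, ‖X ν x‖ ≤ N' * Real.exp (-(δ₂ * tdist m (blockCoord K m (siteCast h x)) v)) := fun x =>
    weighted_row_of_local K m h hm X (fun x => blockCoord K m (siteCast h x)) hBX hN hδ₂0 hδ₂1 hδ₂κ hXv v ν hνv x
  have hXνg : ∀ b : Bond d P, ‖covDeriv ((η : ℂ))⁻¹ (adTransportW φ U) (X ν) b‖ ≤
      N' * Real.exp (-(δ₂ * tdist m (blockCoord K m (siteCast h (bpos b))) v)) := fun b => by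
    have := weighted_row_of_local K m h hm (covDeriv ((η : ℂ))⁻¹ (adTransportW φ U) ∘ₗ X) (fun b => blockCoord K m (siteCast h (bpos b)))
      hBX hN hδ₂0 hδ₂1 hδ₂κ (fun v' g F hg hF b => by rw [LinearMap.comp_apply]; exact hXg v' g F hg hF b) v ν hνv b
    rw [LinearMap.comp_apply] at this
    exact this
  -- the Hölder row of `Xν` (a Lipschitz field at the unit scale is Hölder)
  have hXνh := holderRow_of_gradientRow K m φ hφ hφ' hMφ hMφ' h hm U hη hηK hα hUb hUη (X ν) v hN' hN' hδ₂0 hε1 hXνv hXνg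
  -- weaken `ν`'s rate `δ₁ → δ₂`
  have hwk : ∀ x, Real.exp (-(δ₁ * tdist m (blockCoord K m (siteCast h x)) v)) ≤ Real.exp (-(δ₂ * tdist m (blockCoord K m (siteCast h x)) v)) := fun x =>
    Real.exp_le_exp.2 (by nlinarith [mul_le_mul_of_nonneg_right hδ₂1 (tdist_nonneg m (blockCoord K m (siteCast h x)) v)])
  refine ⟨fun x => ?_, fun x x' hxx => ?_⟩
  · rw [Pi.sub_apply]
    refine (norm_sub_le _ _).trans ?_
    calc ‖ν x‖ + ‖X ν x‖ ≤ N * Real.exp (-(δ₂ * tdist m (blockCoord K m (siteCast h x)) v)) + N' * Real.exp (-(δ₂ * tdist m (blockCoord K m (siteCast h x)) v)) :=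
          add_le_add ((hνv x).trans (mul_le_mul_of_nonneg_left (hwk x) hN)) (hXνv x)
      _ = (N + N') * Real.exp (-(δ₂ * tdist m (blockCoord K m (siteCast h x)) v)) := by ring
  · rw [Pi.sub_apply, Pi.sub_apply, show ν x' - X ν x' - (ν x - X ν x) = (ν x' - ν x) - (X ν x' - X ν x) by abel]
    refine (norm_sub_le _ _).trans ?_
    have hr0 : 0 ≤ (tdist P x x' / K) ^ ε := Real.rpow_nonneg (div_nonneg (tdist_nonneg _ _ _) (Nat.cast_nonneg K)) ε
    calc ‖ν x' - ν x‖ + ‖X ν x' - X ν x‖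
        ≤ H * Real.exp (-(δ₂ * tdist m (blockCoord K m (siteCast h x)) v)) * (tdist P x x' / K) ^ ε +
          d * (N' + 2 * Mφ * Mφ' * α * N') * Real.exp δ₂ * Real.exp (-(δ₂ * tdist m (blockCoord K m (siteCast h x)) v)) * (tdist P x x' / K) ^ ε :=
          add_le_add ((hνh x x' hxx).trans (mul_le_mul_of_nonneg_right (mul_le_mul_of_nonneg_left (hwk x) hH) hr0)) (hXνh x x' hxx)
      _ = _ := by ring

end Literature.MathematicalPhysics.QuantumFieldTheory.Balaban1983to89.B9Eq340WeightedHolderRowsProjectionStep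

end
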